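import Mathlib.RingTheory.Regular.RegularSequence
import Mathlib.RingTheory.Nakayama
import Mathlib.RingTheory.Ideal.Quotient.Operations
import HarnessLib

/-!
# Kernels of presentations modulo a regular sequence (towards de Jong 1996, 2.23)

Topic: `Literature/AlgebraicGeometry/Resolution`. The algebra behind the sentence of de Jong
1996, 2.23

> "By flatness of `B` over `A'`, we see that `B ≅ A'⟦u, v⟧/(Q - h)` for some
> `h ∈ 𝔪_{A'} A'⟦u, v⟧`." (p. 61)

i.e. the computation of the kernel `J` of the presentation `A'⟦u, v⟧ → B` from the kernel
`(q)` of its closed fibre `k'⟦u, v⟧ → B/𝔪_{A'}B`: flatness gives `J ∩ 𝔪 A'⟦u, v⟧ = 𝔪 J`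
(`Tor₁(B, k') = 0`), so `J = (G) + 𝔪J` for any `G ∈ J` lifting `q`, and Nakayama gives
`J = (G)`. The flatness enters only through the vanishing of `Tor₁` against the residue field,
which for a parameter ideal `𝔪 = (t₁, …, t_m)` generated by a sequence that is REGULAR on `B`
is elementary; this is the form in which the statement is proved here (in the application
`t₁, …, t_m` is a regular system of parameters of the regular base `A'`, regular on the flat
`B`), for an arbitrary surjection of modules:

* `ker_inf_ofList_smul_top_le` — for a surjective linear map `π : F → M` with kernel `K` and a
  sequence `rs` weakly regular on `M`, `K ∩ (rs)F ⊆ (rs)K` (induction along the sequence,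
  passing to `M/r₁M`);
* `Ideal.inf_ofList_le_mul_of_isWeaklyRegular` — the case `F = P`, `M = P/J`: `J ∩ I ⊆ IJ` for
  `I = (rs)` with `rs` weakly regular on `P/J`;
* `Ideal.eq_span_singleton_of_isWeaklyRegular` — **the kernel is principal**: if moreover `J` is
  finitely generated, `I ⊆ rad P`, and `J ⊆ (G) + I` for some `G ∈ J` (i.e. `J` is generated by
  the image of `G` modulo `I`), then `J = (G)`;
* `isWeaklyRegular_quotient_ker_iff` — bookkeeping: for a surjective ring homomorphism
  `ψ : P → C`, a sequence `rs` in `P` is weakly regular on the `P`-module `P ⧸ ker ψ` iff its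
  image is weakly regular on `C`.

Everything here is PROVED; no definitions, no named facts.

## Sources

* A. J. de Jong, *Smoothness, semi-stability and alterations*, Publ. Math. IHÉS 83 (1996),
  2.23, p. 61. [DeJong1996]
* H. Matsumura, *Commutative Ring Theory* (1986), Thm. 2.2 (Nakayama), §16 (regular
  sequences). [Matsumura1987]
-/

namespace Literature.AlgebraicGeometry.Resolution

universe u v w

open RingTheory.Sequence Pointwise

/-! ## `K ∩ (rs)F ⊆ (rs)K` for a sequence regular on `F/K` -/

section Modules

variable {P : Type u} [CommRing P] {F : Type v} [AddCommGroup F] [Module P F]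

/-- The preimage of `rM` under a surjection `π : F → M` is `ker π + rF`. [folklore] -/
theorem Submodule.comap_pointwise_smul_top_of_surjective {M : Type w} [AddCommGroup M]
    [Module P M] (π : F →ₗ[P] M) (hπ : Function.Surjective π) (r : P) :
    (r • (⊤ : Submodule P M)).comap π = LinearMap.ker π ⊔ r • ⊤ := by
  refine le_antisymm (fun x hx => ?_) (sup_le (fun x hx => ?_) (fun x hx => ?_))
  · rw [Submodule.mem_comap] at hx
    obtain ⟨m, -, hm⟩ := (Submodule.mem_smul_pointwise_iff_exists _ _ _).mp hx
    obtain ⟨f, rfl⟩ := hπ m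
    have e : x = (x - r • f) + r • f := by abel
    rw [e]
    refine Submodule.add_mem _ (Submodule.mem_sup_left ?_)
      (Submodule.mem_sup_right (Submodule.smul_mem_pointwise_smul f r ⊤ trivial))
    rw [LinearMap.mem_ker, map_sub, map_smul, hm, sub_self]
  · rw [Submodule.mem_comap, LinearMap.mem_ker.mp hx]
    exact Submodule.zero_mem _
  · obtain ⟨f, -, rfl⟩ := (Submodule.mem_smul_pointwise_iff_exists _ _ _).mp hx
    rw [Submodule.mem_comap, map_smul]
    exact Submodule.smul_mem_pointwise_smul _ r ⊤ trivial

/-- `I • (r • N) = r • (I • N)` for an ideal `I`, a scalar `r` and a submodule `N`. [folklore] -/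
theorem Submodule.ideal_smul_pointwise_smul_comm (I : Ideal P) (r : P) (N : Submodule P F) :
    I • (r • N) = r • (I • N) := by
  rw [← Submodule.ideal_span_singleton_smul r N, ← Submodule.mul_smul, mul_comm,
    Submodule.mul_smul, Submodule.ideal_span_singleton_smul]

/-- **`K ∩ (rs)F ⊆ (rs)K` for a weakly regular sequence.** Let `π : F → M` be a surjective
linear map with kernel `K` and `rs = [r₁, …, r_m]` a sequence of scalars weakly regular on `M`.
Then `K ∩ (r₁, …, r_m)F ⊆ (r₁, …, r_m)K` (the other inclusion being obvious): this is the
vanishing of `Tor₁(M, P/(rs))`, proved by induction along the sequence — writing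
`x = r₁f + y ∈ K` with `y ∈ (r₂, …)F`, the element `y` dies in `M/r₁M`, so by induction
(for `F → M/r₁M`, kernel `K + r₁F`) `y ∈ (r₂, …)(K + r₁F)`, i.e. `y = w + r₁z` with
`w ∈ (r₂, …)K`, `z ∈ (r₂, …)F`; then `r₁(f + z) = x - w ∈ K`, so `f + z ∈ K` as `r₁` is a
non-zero-divisor on `M`. [cite: Matsumura1987, §16] -/
theorem ker_inf_ofList_smul_top_le (rs : List P) :
    ∀ {M : Type w} [AddCommGroup M] [Module P M] (π : F →ₗ[P] M),
      Function.Surjective π → IsWeaklyRegular M rs →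
        LinearMap.ker π ⊓ (Ideal.ofList rs • ⊤ : Submodule P F) ≤
          Ideal.ofList rs • LinearMap.ker π := by
  induction rs with
  | nil =>
    intro M _ _ π hπ h
    simp
  | cons r rs ih =>
    intro M _ _ π hπ h
    rw [isWeaklyRegular_cons_iff] at h
    obtain ⟨hr, hrs⟩ := h
    -- the induction hypothesis for `F → M → M/rM`, whose kernel is `K + rF`
    set π' : F →ₗ[P] QuotSMulTop r M := (r • (⊤ : Submodule P M)).mkQ ∘ₗ π with hπ'def
    have hπ' : Function.Surjective π' := (Submodule.mkQ_surjective _).comp hπ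
    have hker' : LinearMap.ker π' = LinearMap.ker π ⊔ r • ⊤ := by
      rw [hπ'def, LinearMap.ker_comp, Submodule.ker_mkQ,
        Submodule.comap_pointwise_smul_top_of_surjective π hπ r]
    have IH := ih π' hπ' hrs
    rw [hker'] at IH
    -- decompose `x = r • f + y`
    rintro x ⟨hxK, hxI⟩
    rw [SetLike.mem_coe, Ideal.ofList_cons_smul, Submodule.mem_sup] at hxI
    obtain ⟨a, ha, y, hy, rfl⟩ := hxI
    obtain ⟨f, -, rfl⟩ := (Submodule.mem_smul_pointwise_iff_exists _ _ _).mp ha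
    -- `y ∈ (K + rF) ∩ (rs)F ⊆ (rs)(K + rF) = (rs)K + r (rs)F`
    have hyK' : y ∈ LinearMap.ker π ⊔ r • (⊤ : Submodule P F) := by
      have e : y = (r • f + y) - r • f := by abel
      rw [e]
      exact Submodule.sub_mem _ (Submodule.mem_sup_left hxK)
        (Submodule.mem_sup_right (Submodule.smul_mem_pointwise_smul f r ⊤ trivial))
    have hy2 : y ∈ Ideal.ofList rs • (LinearMap.ker π ⊔ r • (⊤ : Submodule P F)) :=
      IH ⟨hyK', hy⟩
    rw [Submodule.smul_sup, Submodule.ideal_smul_pointwise_smul_comm, Submodule.mem_sup] at hy2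
    obtain ⟨w, hw, b, hb, rfl⟩ := hy2
    obtain ⟨z, -, rfl⟩ := (Submodule.mem_smul_pointwise_iff_exists _ _ _).mp hb
    -- `r • (f + z) ∈ K`, hence `f + z ∈ K`
    have hwK : w ∈ LinearMap.ker π := Submodule.smul_le_right hw
    have hrK : r • (f + z) ∈ LinearMap.ker π := by
      have e : r • (f + z) = (r • f + (w + r • z)) - w := by rw [smul_add]; abel
      rw [e]
      exact Submodule.sub_mem _ hxK hwK
    have hfz : f + z ∈ LinearMap.ker π := by
      rw [LinearMap.mem_ker] at hrK ⊢
      rw [map_smul] at hrK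
      exact (isSMulRegular_iff_right_eq_zero_of_smul.mp hr) _ hrK
    -- conclusion
    have e : r • f + (w + r • z) = r • (f + z) + w := by rw [smul_add]; abel
    rw [e, Ideal.ofList_cons_smul]
    exact Submodule.add_mem _
      (Submodule.mem_sup_left (Submodule.smul_mem_pointwise_smul _ r _ hfz))
      (Submodule.mem_sup_right hw)

end Modules

/-! ## Ideals: `J ∩ I ⊆ IJ` and the principal kernel -/

section Ideals

variable {P : Type u} [CommRing P]

/-- **`J ∩ (rs) ⊆ (rs)J` when `rs` is weakly regular on `P/J`** (the case `F = P`, `M = P/J`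
of `ker_inf_ofList_smul_top_le`). [cite: Matsumura1987, §16] -/
theorem Ideal.inf_ofList_le_mul_of_isWeaklyRegular {J : Ideal P} {rs : List P}
    (hreg : IsWeaklyRegular (P ⧸ J) rs) : J ⊓ Ideal.ofList rs ≤ Ideal.ofList rs * J := by
  have h := ker_inf_ofList_smul_top_le (F := P) rs (Submodule.mkQ J) (Submodule.mkQ_surjective J)
    hreg
  rw [Submodule.ker_mkQ] at h
  intro x hx
  have hx' : x ∈ J ⊓ (Ideal.ofList rs • ⊤ : Submodule P P) := by
    refine ⟨hx.1, ?_⟩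
    rw [smul_eq_mul, Ideal.mul_top]
    exact hx.2
  exact h hx'

/-- **The kernel is principal** (de Jong 1996, 2.23: "By flatness of `B` over `A'`, we see that
`B ≅ A'⟦u, v⟧/(Q - h)`"). Let `J ⊆ P` be a finitely generated ideal, `rs` a sequence in `P`
which is weakly regular on `P/J` and generates an ideal `I` contained in the Jacobson radical,
and `G ∈ J` an element generating `J` modulo `I` (`J ⊆ (G) + I`). Then `J = (G)`: indeed
`J ⊆ (G) + (J ∩ I) ⊆ (G) + IJ`, and Nakayama applies. [cite: DeJong1996, 2.23, p. 61] -/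
theorem Ideal.eq_span_singleton_of_isWeaklyRegular {J : Ideal P} (hJ : J.FG) {rs : List P}
    (hreg : IsWeaklyRegular (P ⧸ J) rs) (hjac : Ideal.ofList rs ≤ Ideal.jacobson ⊥) {G : P}
    (hG : G ∈ J) (hgen : J ≤ Ideal.span {G} ⊔ Ideal.ofList rs) : J = Ideal.span {G} := by
  refine le_antisymm ?_ ((Ideal.span_singleton_le_iff_mem _).mpr hG)
  refine Submodule.le_of_le_smul_of_le_jacobson_bot hJ hjac fun j hj => ?_
  obtain ⟨g, hg, i, hi, rfl⟩ := Submodule.mem_sup.mp (hgen hj)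
  have hiJ : i ∈ J := by
    have e : i = (g + i) - g := by abel
    rw [e]
    exact Submodule.sub_mem _ hj ((Ideal.span_singleton_le_iff_mem _).mpr hG hg)
  have hi' : i ∈ Ideal.ofList rs * J := Ideal.inf_ofList_le_mul_of_isWeaklyRegular hreg ⟨hiJ, hi⟩
  exact Submodule.mem_sup.mpr ⟨g, hg, i, hi', rfl⟩

/-- **Bookkeeping: regularity on `C` versus on `P ⧸ ker ψ`.** For a surjective ring
homomorphism `ψ : P → C` and a sequence `rs` in `P`, `rs` is weakly regular on the `P`-module
`P ⧸ ker ψ` iff `ψ(rs)` is weakly regular on `C`. [folklore] -/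
theorem isWeaklyRegular_quotient_ker_iff {C : Type v} [CommRing C] (ψ : P →+* C)
    (hψ : Function.Surjective ψ) (rs : List P) :
    IsWeaklyRegular (P ⧸ RingHom.ker ψ) rs ↔ IsWeaklyRegular C (rs.map ψ) := by
  let e : (P ⧸ RingHom.ker ψ) ≃+* C := RingHom.quotientKerEquivOfSurjective hψ
  refine e.toAddEquiv.isWeaklyRegular_congr (List.forall₂_map_right_iff.mpr ?_)
  refine List.forall₂_same.mpr fun r _ x => ?_
  obtain ⟨x, rfl⟩ := Ideal.Quotient.mk_surjective x
  show e (r • Ideal.Quotient.mk (RingHom.ker ψ) x) = ψ r • e (Ideal.Quotient.mk (RingHom.ker ψ) x)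
  rw [Algebra.smul_def, Ideal.Quotient.algebraMap_eq, ← map_mul, smul_eq_mul]
  show RingHom.quotientKerEquivOfSurjective hψ (Ideal.Quotient.mk _ (r * x)) =
    ψ r * RingHom.quotientKerEquivOfSurjective hψ (Ideal.Quotient.mk _ x)
  rw [RingHom.quotientKerEquivOfSurjective_apply_mk, RingHom.quotientKerEquivOfSurjective_apply_mk,
    map_mul]

end Ideals

end Literature.AlgebraicGeometry.Resolution
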